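import Mathlib.Analysis.Convex.Star
import Mathlib.Analysis.Normed.Module.Convex
import Mathlib.Topology.Connected.Clopen
import Literature.AlgebraicTopology.SingularHomology.FundamentalClass
import HarnessLib

/-!
# Local homology along chart balls: star-convex pieces, good balls, continuation of zeros

A. Hatcher, *Algebraic Topology*, CUP 2002, §3.3, pp. 234–238 (the canonical isomorphisms
`Hₙ(M | B) ≈ Hₙ(M | x)` for chart balls, and step (3) of the proof of Lemma 3.27: "the map
`Hᵢ(ℝⁿ | A) → Hᵢ(ℝⁿ | x)` is an isomorphism for any `x ∈ A`, as both `ℝⁿ - A` and `ℝⁿ - {x}`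
deformation retract onto a sphere centered at `x`", here carried out *inside a chart* of a
manifold `X`, so that no excision is needed).

For a Hausdorff space `X` charted over a proper real normed space `E` (a topological manifold when
`E = ℝⁿ`), a chart `c`, a point `q` of the chart with `closedBall q ρ ⊆ c.target`, and a subset
`C ⊆ ball q ρ` of the chart which is star-convex about `q ∋ C`, we prove (all sorry-free):

* `Literature.AlgebraicTopology.SingularHomology.isIso_restrictLocal_of_starConvex_chart`: the restriction
  `Hᵢ(X | c⁻¹(ball q ρ)) ⟶ Hᵢ(X | c⁻¹ C)` is an isomorphism (radial push-out from `q` beyond radius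
  `ρ` is a retraction `X ∖ c⁻¹C → X ∖ c⁻¹(ball q ρ)` homotopy inverse to the inclusion; then
  `Literature.AlgebraicTopology.SingularHomology.isIso_restrictLocal_of_retract`);
* `Literature.AlgebraicTopology.SingularHomology.isIso_restrictToPoint_of_starConvex_chart`, `Literature.AlgebraicTopology.SingularHomology.isIso_restrictToPoint_of_convex_chart`:
  `Hᵢ(X | c⁻¹ C) ⟶ Hᵢ(X | x)` is an isomorphism for `C` star-convex about `c x` (resp. convex and
  small, any `x ∈ c⁻¹ C`) — Hatcher's step (3);
* `Literature.AlgebraicTopology.SingularHomology.exists_isOpen_forall_isIso_restrictToPoint` (**good balls**): every neighbourhood of `x`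
  contains an open `B ∋ x` with `Hᵢ(X | B) ⟶ Hᵢ(X | y)` an isomorphism for *every* `y ∈ B`
  (Hatcher p. 234/236: the maps `Hₙ(M | B) → Hₙ(M | y)` for an open ball `B`);
* `Literature.AlgebraicTopology.SingularHomology.singularHomology.toLocal_eq_zero_of_toLocal_eq_zero` (**continuation of zeros**): on a
  connected manifold, a class `α ∈ Hₙ(X; M)` whose image in `Hₙ(X | x; M)` vanishes for one `x`
  has vanishing image in every `Hₙ(X | y; M)` (Hatcher p. 236, proof of Thm. 3.26 from Lemma 3.27:
  "each section is uniquely determined by its value at one point"; here for an arbitrary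
  coefficient module, by the clopen argument with good balls).

## References

* A. Hatcher, *Algebraic Topology*, CUP 2002, §3.3, pp. 233–238.
-/

noncomputable section

open CategoryTheory Limits Topology Metric Set

universe u v

namespace Literature.AlgebraicTopology.SingularHomology

variable (R : Type v) [CommRing R] (M : Type v) [AddCommGroup M] [Module R M]
variable {X : Type u} [TopologicalSpace X]

open unitInterval

section StarConvex

variable {E : Type*} [AddCommGroup E] [Module ℝ E]

/-- Points beyond a star-shaped set stay beyond it: if `K` is star-shaped about `x` and
`x + t • (v - x) ∈ K` for some `t ≥ 1`, then `v ∈ K` (elementary). [folklore] -/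
lemma mem_of_one_le_of_add_smul_sub_mem {K : Set E} {x v : E} (hK : StarConvex ℝ x K) {t : ℝ}
    (ht : 1 ≤ t) (h : x + t • (v - x) ∈ K) : v ∈ K := by
  have ht0 : 0 < t := by linarith
  have key := hK h (a := 1 - t⁻¹) (b := t⁻¹) (by rw [sub_nonneg]; exact inv_le_one_of_one_le₀ ht)
    (by positivity) (by ring)
  have e : (1 - t⁻¹) • x + t⁻¹ • (x + t • (v - x)) = v := by
    rw [smul_add, smul_smul, inv_mul_cancel₀ ht0.ne', one_smul]
    module
  rwa [e] at key

end StarConvex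

section Chart

variable [T2Space X] {E : Type*} [NormedAddCommGroup E] [NormedSpace ℝ E] [ProperSpace E]

/-- **Star-convex pieces of a chart.** Let `c` be a chart of the Hausdorff space `X` with values in
a proper real normed space `E`, `q` a point with `closedBall q ρ ⊆ c.target` (`ρ > 0`), and
`C` star-convex about `q ∈ C`. Then for `K = c⁻¹ C ⊆ B = c⁻¹(ball q ρ)` (preimages within
`c.source`) the restriction `Hᵢ(X | B; M) ⟶ Hᵢ(X | K; M)` is an isomorphism for all `i`:
the radial push-out from `q` beyond radius `ρ` (transported by the chart, the identity off the
closed chart ball) is a retraction `X ∖ K → X ∖ B` which is a homotopy inverse of the inclusion,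
by star-convexity (Hatcher 2002, §3.3, proof of Lemma 3.27, step (3), p. 237: "both `ℝⁿ - A` and
`ℝⁿ - {x}` deformation retract onto a sphere centered at `x`"; and p. 234 for `C = {q}`).
[cite: Hatcher2002, §3.3  proof of Lemma 3.27 step (3)  p. 237] -/
theorem isIso_restrictLocal_of_starConvex_chart (c : OpenPartialHomeomorph X E) {q : E} {ρ : ℝ}
    (hρ : 0 < ρ) (hρt : closedBall q ρ ⊆ c.target) {C : Set E} (hC : StarConvex ℝ q C)
    (hqC : q ∈ C) {K B : Set X} (hK : K = c.source ∩ c ⁻¹' C)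
    (hB : B = c.source ∩ c ⁻¹' ball q ρ) (hKB : K ⊆ B) (i : ℕ) :
    IsIso (restrictLocal R M hKB i) := by
  subst hK hB
  classical
  have hqt : q ∈ c.target := hρt (mem_closedBall_self hρ.le)
  set x₀ : X := c.symm q with hx₀
  have hx₀s : x₀ ∈ c.source := c.map_target hqt
  have hcx₀ : c x₀ = q := c.right_inv hqt
  set D : Set X := c.source ∩ c ⁻¹' closedBall q ρ with hD
  have hDc : IsClosed D := by
    rw [hD, ← c.symm_image_eq_source_inter_preimage hρt]
    exact ((isCompact_closedBall q ρ).image_of_continuousOn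
      (c.continuousOn_symm.mono hρt)).isClosed
  have hBo : IsOpen (c.source ∩ c ⁻¹' ball q ρ) := c.isOpen_inter_preimage isOpen_ball
  have hBD : c.source ∩ c ⁻¹' ball q ρ ⊆ D := fun y hy ↦ ⟨hy.1, ball_subset_closedBall hy.2⟩
  have hx₀K : x₀ ∈ c.source ∩ c ⁻¹' C := ⟨hx₀s, by rw [mem_preimage, hcx₀]; exact hqC⟩
  have hne : ∀ y ∈ D, y ≠ x₀ → c y ≠ q := fun y hy hyx h ↦
    hyx (c.injOn hy.1 hx₀s (h.trans hcx₀.symm))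
  have hnorm : ∀ y ∈ D, ‖c y - q‖ ≤ ρ := fun y hy ↦ by rw [← dist_eq_norm]; exact hy.2
  have hsphere : ∀ y ∈ D, y ∉ c.source ∩ c ⁻¹' ball q ρ → ‖c y - q‖ = ρ := fun y hy hyB ↦
    le_antisymm (hnorm y hy) (by
      rw [← dist_eq_norm]; exact not_lt.1 fun h ↦ hyB ⟨hy.1, h⟩)
  -- the push-out coefficient `μ t v = (1 - t) max(1, ρ/‖v - q‖) + t ≥ 1` and map `P t v`
  let μ : ℝ → E → ℝ := fun t v ↦ (1 - t) * max 1 (ρ / ‖v - q‖) + t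
  let P : ℝ → E → E := fun t v ↦ q + μ t v • (v - q)
  have one_le_μ : ∀ {t : ℝ}, 0 ≤ t → t ≤ 1 → ∀ v, 1 ≤ μ t v := fun {t} ht0 ht1 v ↦ by
    have h1 : (0 : ℝ) ≤ 1 - t := by linarith
    show 1 ≤ (1 - t) * max 1 (ρ / ‖v - q‖) + t
    nlinarith [le_max_left (1 : ℝ) (ρ / ‖v - q‖)]
  have μ_of_le : ∀ (t : ℝ) {v : E}, v ≠ q → ‖v - q‖ ≤ ρ →
      μ t v * ‖v - q‖ = (1 - t) * ρ + t * ‖v - q‖ := fun t {v} hv hvρ ↦ by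
    have hd : 0 < ‖v - q‖ := norm_pos_iff.2 (sub_ne_zero.2 hv)
    have hmax : max 1 (ρ / ‖v - q‖) = ρ / ‖v - q‖ :=
      max_eq_right ((one_le_div hd).2 hvρ)
    show ((1 - t) * max 1 (ρ / ‖v - q‖) + t) * ‖v - q‖ = _
    rw [hmax, add_mul, mul_assoc, div_mul_cancel₀ _ hd.ne']
  have norm_P : ∀ {t : ℝ}, 0 ≤ t → t ≤ 1 → ∀ {v : E}, v ≠ q → ‖v - q‖ ≤ ρ →
      ‖P t v - q‖ = (1 - t) * ρ + t * ‖v - q‖ := fun {t} ht0 ht1 {v} hv hvρ ↦ by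
    show ‖q + μ t v • (v - q) - q‖ = _
    rw [add_sub_cancel_left, norm_smul,
      Real.norm_of_nonneg (zero_le_one.trans (one_le_μ ht0 ht1 v)), μ_of_le t hv hvρ]
  have P_mem : ∀ {t : ℝ}, 0 ≤ t → t ≤ 1 → ∀ {v : E}, v ≠ q → ‖v - q‖ ≤ ρ →
      P t v ∈ closedBall q ρ := fun {t} ht0 ht1 {v} hv hvρ ↦ by
    rw [mem_closedBall, dist_eq_norm, norm_P ht0 ht1 hv hvρ]
    nlinarith
  have P_of_eq : ∀ (t : ℝ) {v : E}, ‖v - q‖ = ρ → P t v = v := fun t {v} hv ↦ by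
    show q + ((1 - t) * max 1 (ρ / ‖v - q‖) + t) • (v - q) = v
    rw [hv, div_self hρ.ne', max_self, mul_one, sub_add_cancel, one_smul, add_sub_cancel]
  have P_one : ∀ v : E, P 1 v = v := fun v ↦ by
    show q + ((1 - 1) * max 1 (ρ / ‖v - q‖) + 1) • (v - q) = v
    rw [sub_self, zero_mul, zero_add, one_smul, add_sub_cancel]
  have P_ne : ∀ {t : ℝ}, 0 ≤ t → t ≤ 1 → ∀ {v : E}, v ≠ q → P t v ≠ q := by
    intro t ht0 ht1 v hv h
    have h' : μ t v • (v - q) = 0 := by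
      have := congrArg (· - q) h
      simpa [P] using this
    rcases smul_eq_zero.1 h' with h'' | h''
    · linarith [one_le_μ ht0 ht1 v]
    · exact hv (sub_eq_zero.1 h'')
  have P_not_mem : ∀ {t : ℝ}, 0 ≤ t → t ≤ 1 → ∀ {v : E}, v ∉ C → P t v ∉ C :=
    fun {t} ht0 ht1 {v} hv h ↦ hv (mem_of_one_le_of_add_smul_sub_mem hC (one_le_μ ht0 ht1 v) h)
  have P_zero_not_mem : ∀ {v : E}, v ≠ q → ‖v - q‖ ≤ ρ → P 0 v ∉ ball q ρ := by
    intro v hv hvρ h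
    rw [mem_ball, dist_eq_norm, norm_P le_rfl zero_le_one hv hvρ] at h
    linarith
  have hPc : ContinuousOn (fun z : ℝ × E ↦ P z.1 z.2) {z | z.2 ≠ q} := by
    have hs : Continuous (fun z : ℝ × E ↦ z.1) := continuous_fst
    have hcoef : ContinuousOn (fun z : ℝ × E ↦ μ z.1 z.2) {z : ℝ × E | z.2 ≠ q} := by
      refine (((continuous_const.sub hs).continuousOn).mul (continuous_max.comp_continuousOn
        (continuousOn_const.prodMk (continuousOn_const.div ?_ fun p hp ↦ ?_)))).add hs.continuousOn
      · fun_prop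
      · rw [norm_ne_zero_iff, sub_ne_zero]
        exact hp
    exact continuousOn_const.add (hcoef.smul (by fun_prop))
  -- the deformation of `X ∖ K` onto `X ∖ B`, transported by the chart
  let F : I × X → X := fun z ↦ if z.2 ∈ D then c.symm (P z.1 (c z.2)) else z.2
  have hFD : ∀ (t : I) (y : X), y ∈ D → F (t, y) = c.symm (P t (c y)) := fun t y hy ↦ if_pos hy
  have hFD' : ∀ (t : I) (y : X), y ∉ D → F (t, y) = y := fun t y hy ↦ if_neg hy
  have hmem : ∀ (t : I), ∀ y ∈ D, y ≠ x₀ → P t (c y) ∈ closedBall q ρ := fun t y hy hyx ↦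
    P_mem t.2.1 t.2.2 (hne y hy hyx) (hnorm y hy)
  -- `F` preserves the complement of `K`
  have hFK : ∀ (t : I) (y : X), y ∉ c.source ∩ c ⁻¹' C → F (t, y) ∉ c.source ∩ c ⁻¹' C := by
    intro t y hyK
    by_cases hy : y ∈ D
    · have hyx : y ≠ x₀ := fun h ↦ hyK (h ▸ hx₀K)
      rw [hFD t y hy]
      rintro ⟨-, h⟩
      rw [mem_preimage, c.right_inv (hρt (hmem t y hy hyx))] at h
      exact P_not_mem t.2.1 t.2.2 (fun h' ↦ hyK ⟨hy.1, h'⟩) h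
    · rwa [hFD' t y hy]
  -- at time `0`, `F` lands outside `B`
  have hF0 : ∀ y : X, y ∉ c.source ∩ c ⁻¹' C → F (0, y) ∉ c.source ∩ c ⁻¹' ball q ρ := by
    intro y hyK
    by_cases hy : y ∈ D
    · have hyx : y ≠ x₀ := fun h ↦ hyK (h ▸ hx₀K)
      rw [hFD 0 y hy]
      rintro ⟨-, h⟩
      rw [mem_preimage, c.right_inv (hρt (hmem 0 y hy hyx))] at h
      exact P_zero_not_mem (hne y hy hyx) (hnorm y hy) h
    · rw [hFD' 0 y hy]
      exact fun h ↦ hy (hBD h)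
  -- at time `0`, `F` fixes the complement of `B`
  have hF0' : ∀ y : X, y ∉ c.source ∩ c ⁻¹' ball q ρ → F (0, y) = y := by
    intro y hyB
    by_cases hy : y ∈ D
    · rw [hFD 0 y hy, P_of_eq _ (hsphere y hy hyB), c.left_inv hy.1]
    · exact hFD' 0 y hy
  have hF1 : ∀ y : X, F (1, y) = y := by
    intro y
    by_cases hy : y ∈ D
    · rw [hFD 1 y hy, Set.Icc.coe_one, P_one, c.left_inv hy.1]
    · exact hFD' 1 y hy
  have hFc : ContinuousOn F {z | z.2 ≠ x₀} := by
    apply ContinuousOn.if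
    · rintro ⟨t, y⟩ ⟨hyx : y ≠ x₀, hfr⟩
      have hyD : y ∈ D := frontier_subset_iff_isClosed.2 (hDc.preimage continuous_snd) hfr
      have hyB : y ∉ c.source ∩ c ⁻¹' ball q ρ := fun h ↦
        hfr.2 (interior_maximal (s := {a : I × X | a.2 ∈ D})
          (t := Prod.snd ⁻¹' (c.source ∩ c ⁻¹' ball q ρ))
          (fun z hz ↦ hBD hz) (hBo.preimage continuous_snd) h)
      simp only
      rw [P_of_eq _ (hsphere y hyD hyB), c.left_inv hyD.1]
    · have hcl : closure {a : I × X | a.2 ∈ D} = {a | a.2 ∈ D} :=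
        (hDc.preimage continuous_snd).closure_eq
      rw [hcl]
      refine c.continuousOn_symm.comp (hPc.comp
        ((continuous_subtype_val.comp continuous_fst).continuousOn.prodMk
          (c.continuousOn.comp continuousOn_snd fun z hz ↦ hz.2.1)) ?_) ?_
      · exact fun z hz ↦ hne z.2 hz.2 hz.1
      · exact fun z hz ↦ hρt (hmem z.1 z.2 hz.2 hz.1)
    · exact continuousOn_snd
  -- assemble the retraction and the homotopy
  have hKx : ∀ y : X, y ∉ c.source ∩ c ⁻¹' C → y ≠ x₀ := fun y hy h ↦ hy (h ▸ hx₀K)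
  let r : C(((c.source ∩ c ⁻¹' C)ᶜ : Set X), ((c.source ∩ c ⁻¹' ball q ρ)ᶜ : Set X)) :=
    ⟨fun y ↦ ⟨F (0, y), hF0 y y.2⟩,
      (hFc.comp_continuous (continuous_const.prodMk continuous_subtype_val)
        fun y ↦ by exact hKx _ y.2).subtype_mk _⟩
  refine isIso_restrictLocal_of_retract R M hKB r
    (ContinuousMap.ext fun y ↦ Subtype.ext (hF0' y y.2)) ⟨?_⟩ i
  exact
    { toFun := fun z ↦ ⟨F (z.1, z.2), hFK z.1 z.2 z.2.2⟩
      continuous_toFun := (hFc.comp_continuous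
        (continuous_fst.prodMk (continuous_subtype_val.comp continuous_snd))
        fun z ↦ by exact hKx _ z.2.2).subtype_mk _
      map_zero_left := fun y ↦ rfl
      map_one_left := fun y ↦ Subtype.ext (hF1 y) }

/-- **Restriction to the centre of a star-convex chart piece is an isomorphism.** With `c`, `ρ`
as above, `x ∈ c.source`, and `C ⊆ ball (c x) ρ` star-convex about `c x ∈ C`, the restriction
`Hᵢ(X | c⁻¹ C; M) ⟶ Hᵢ(X | x; M)` is an isomorphism for all `i`: both `Hᵢ(X | c⁻¹(ball)) ⟶
Hᵢ(X | c⁻¹ C)` and `Hᵢ(X | c⁻¹(ball)) ⟶ Hᵢ(X | x)` are (previous result, the second with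
`C = {c x}`), and the three restrictions compose (Hatcher 2002, §3.3, proof of Lemma 3.27,
step (3), p. 237). [cite: Hatcher2002, §3.3  proof of Lemma 3.27 step (3)  p. 237] -/
theorem isIso_restrictToPoint_of_starConvex_chart (c : OpenPartialHomeomorph X E) {x : X}
    (hx : x ∈ c.source) {ρ : ℝ} (hρ : 0 < ρ) (hρt : closedBall (c x) ρ ⊆ c.target) {C : Set E}
    (hC : StarConvex ℝ (c x) C) (hxC : c x ∈ C) (hCρ : C ⊆ ball (c x) ρ) {K : Set X}
    (hK : K = c.source ∩ c ⁻¹' C) (hxK : x ∈ K) (i : ℕ) :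
    IsIso (restrictToPoint R M hxK i) := by
  set B : Set X := c.source ∩ c ⁻¹' ball (c x) ρ with hB
  have hKB : K ⊆ B := by
    rw [hK]
    exact fun y hy ↦ ⟨hy.1, hCρ hy.2⟩
  haveI h1 : IsIso (restrictLocal R M hKB i) :=
    isIso_restrictLocal_of_starConvex_chart R M c hρ hρt hC hxC hK hB hKB i
  have hxB : ({x} : Set X) ⊆ B := singleton_subset_iff.2 (hKB hxK)
  have hx' : ({x} : Set X) = c.source ∩ c ⁻¹' {c x} := by
    ext y
    simp only [mem_singleton_iff, mem_inter_iff, mem_preimage]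
    constructor
    · rintro rfl
      exact ⟨hx, rfl⟩
    · rintro ⟨hy, h⟩
      exact c.injOn hy hx h
  have h2 : IsIso (restrictLocal R M hxB i) :=
    isIso_restrictLocal_of_starConvex_chart R M c hρ hρt (starConvex_singleton (c x))
      (mem_singleton _) hx' hB hxB i
  have hcomp : restrictLocal R M hKB i ≫ restrictToPoint R M hxK i = restrictLocal R M hxB i :=
    restrictLocal_comp R M _ _ i
  haveI : IsIso (restrictLocal R M hKB i ≫ restrictToPoint R M hxK i) := by
    rw [hcomp]
    exact h2
  exact IsIso.of_isIso_comp_left (restrictLocal R M hKB i) _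

/-- **Convex chart pieces** (Hatcher 2002, §3.3, proof of Lemma 3.27, step (3), p. 237: "When `A`
is convex the result is evident since the map `Hᵢ(ℝⁿ | A) → Hᵢ(ℝⁿ | x)` is an isomorphism for any
`x ∈ A`"). In a chart `c` with `closedBall p (4 r) ⊆ c.target`, for a convex `C ⊆ closedBall p r`
and `K = c⁻¹ C`, the restriction `Hᵢ(X | K; M) ⟶ Hᵢ(X | x; M)` is an isomorphism for every
`x ∈ K` and every `i`. [cite: Hatcher2002, §3.3  proof of Lemma 3.27 step (3)  p. 237] -/
theorem isIso_restrictToPoint_of_convex_chart (c : OpenPartialHomeomorph X E) {p : E} {r : ℝ}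
    (hr : 0 < r) (h4 : closedBall p (4 * r) ⊆ c.target) {C : Set E} (hCc : Convex ℝ C)
    (hCr : C ⊆ closedBall p r) {K : Set X} (hK : K = c.source ∩ c ⁻¹' C) {x : X} (hxK : x ∈ K)
    (i : ℕ) : IsIso (restrictToPoint R M hxK i) := by
  have hx : x ∈ c.source ∧ c x ∈ C := by
    rw [hK] at hxK
    exact hxK
  have hxp : dist (c x) p ≤ r := hCr hx.2
  refine isIso_restrictToPoint_of_starConvex_chart R M c hx.1 (ρ := 3 * r) (by positivity)
    ((closedBall_subset_closedBall' (by linarith)).trans h4) (hCc.starConvex hx.2) hx.2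
    (fun v hv ↦ ?_) hK hxK i
  rw [mem_ball]
  calc dist v (c x) ≤ dist v p + dist p (c x) := dist_triangle _ _ _
    _ ≤ r + r := add_le_add (hCr hv) (by rw [dist_comm]; exact hxp)
    _ < 3 * r := by linarith

variable (E) [ChartedSpace E X]

include E

/-- **Good balls** (Hatcher 2002, §3.3, p. 234 and p. 236: for an open ball `B` in a chart the
maps `Hₙ(M | B) → Hₙ(M | y)`, `y ∈ B`, are isomorphisms). On a Hausdorff space charted over a
proper real normed space, every neighbourhood `U` of `x` contains an open `B ∋ x` such that the
restriction `Hᵢ(X | B; M) ⟶ Hᵢ(X | y; M)` is an isomorphism for *every* `y ∈ B` and every `i`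
(`B` is the preimage of a small chart ball about `x`, which is star-convex about each of its
points). [cite: Hatcher2002, §3.3  p. 234  p. 236] -/
theorem exists_isOpen_forall_isIso_restrictToPoint (x : X) {U : Set X} (hU : U ∈ 𝓝 x) :
    ∃ B : Set X, ∃ _ : x ∈ B, IsOpen B ∧ B ⊆ U ∧
      ∀ (y : X) (hy : y ∈ B) (i : ℕ), IsIso (restrictToPoint R M hy i) := by
  set c := chartAt E x with hc
  set p : E := c x with hp
  have hxc : x ∈ c.source := mem_chart_source E x
  have hpt : p ∈ c.target := mem_chart_target E x
  have hW : c.target ∩ c.symm ⁻¹' U ∈ 𝓝 p :=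
    Filter.inter_mem (chart_target_mem_nhds E x)
      ((c.continuousAt_symm hpt).preimage_mem_nhds (by rwa [c.left_inv hxc]))
  obtain ⟨R₀, hR₀, hRW⟩ := Metric.nhds_basis_closedBall.mem_iff.1 hW
  set r : ℝ := R₀ / 3 with hr
  have hr0 : 0 < r := by positivity
  have h3 : closedBall p (3 * r) ⊆ c.target := by
    rw [show 3 * r = R₀ by rw [hr]; ring]
    exact hRW.trans inter_subset_left
  refine ⟨c.source ∩ c ⁻¹' ball p r, ⟨hxc, mem_ball_self hr0⟩,
    c.isOpen_inter_preimage isOpen_ball, fun y hy ↦ ?_, fun y hy i ↦ ?_⟩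
  · have : c y ∈ closedBall p R₀ :=
      (closedBall_subset_closedBall (by rw [hr]; linarith)) (ball_subset_closedBall hy.2)
    have := (hRW this).2
    rwa [mem_preimage, c.left_inv hy.1] at this
  · have hyq : dist (c y) p < r := hy.2
    refine isIso_restrictToPoint_of_starConvex_chart R M c hy.1 (ρ := 2 * r) (by positivity)
      ((closedBall_subset_closedBall' (by linarith)).trans h3)
      ((convex_ball p r).starConvex hy.2) hy.2 (fun v hv ↦ ?_) rfl hy i
    rw [mem_ball] at hv ⊢
    calc dist v (c y) ≤ dist v p + dist p (c y) := dist_triangle _ _ _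
      _ < r + r := add_lt_add hv (by rwa [dist_comm])
      _ = 2 * r := by ring

/-- **Continuation of zeros** (Hatcher 2002, §3.3, p. 236, proof of Thm. 3.26: "If `M` is
connected, each section is uniquely determined by its value at one point"; here for coefficients
in an arbitrary module). On a connected manifold (a preconnected Hausdorff space charted over a
proper real normed space), if `α ∈ Hₙ(X; M)` has zero image in `Hₙ(X | x; M)` for one point `x`,
then it has zero image in `Hₙ(X | y; M)` for every `y`: the set of such points is open and closed,
both by the good balls `B` (`Hₙ(X | B) → Hₙ(X | y)` injective for all `y ∈ B`).
[cite: Hatcher2002, §3.3  p. 236  proof of Thm. 3.26] -/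
theorem singularHomology.toLocal_eq_zero_of_toLocal_eq_zero [PreconnectedSpace X] {n : ℕ}
    (α : singularHomology R M X n) {x : X} (hx : singularHomology.toLocal R M x n α = 0) (y : X) :
    singularHomology.toLocal R M y n α = 0 := by
  let S : Set X := {z | singularHomology.toLocal R M z n α = 0}
  -- near every point, vanishing at one point of a good ball is vanishing on the whole ball
  have key : ∀ z : X, ∃ B ∈ 𝓝 z, ∀ w ∈ B, ∀ w' ∈ B,
      singularHomology.toLocal R M w n α = 0 → singularHomology.toLocal R M w' n α = 0 := by
    intro z
    obtain ⟨B, hzB, hBo, -, hB⟩ :=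
      exists_isOpen_forall_isIso_restrictToPoint R M E z (U := univ) Filter.univ_mem
    refine ⟨B, hBo.mem_nhds hzB, fun w hw w' hw' h ↦ ?_⟩
    have hαB : singularHomology.toLocalOfSet R M X B n α = 0 := by
      haveI := hB w hw n
      apply (ModuleCat.mono_iff_injective (restrictToPoint R M hw n)).1 inferInstance
      rw [map_zero, singularHomology.restrictToPoint_toLocalOfSet, h]
    rw [← singularHomology.restrictToPoint_toLocalOfSet R M hw', hαB, map_zero]
  have hSo : IsOpen S := isOpen_iff_mem_nhds.2 fun z (hz : singularHomology.toLocal R M z n α = 0) ↦ by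
    obtain ⟨B, hB, h⟩ := key z
    exact Filter.mem_of_superset hB fun w hw ↦ h z (mem_of_mem_nhds hB) w hw hz
  have hSc : IsClosed S := by
    rw [← isOpen_compl_iff, isOpen_iff_mem_nhds]
    intro z hz
    obtain ⟨B, hB, h⟩ := key z
    exact Filter.mem_of_superset hB fun w hw (hw' : singularHomology.toLocal R M w n α = 0) ↦
      hz (h w hw z (mem_of_mem_nhds hB) hw')
  have hS : S = univ := IsClopen.eq_univ ⟨hSc, hSo⟩ ⟨x, hx⟩
  exact (Set.eq_univ_iff_forall.1 hS y : singularHomology.toLocal R M y n α = 0)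

end Chart

end Literature.AlgebraicTopology.SingularHomology
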